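import Summits.ResolutionOfSingularities.ResolutionOfSingularities.Theorems.PAlterationAssembly2
import Summits.ResolutionOfSingularities.ResolutionOfSingularities.Theorems.PAlterationPialtReductions
import HarnessLib

/-!
# `Pialt` (crux stmt-ResolutionOfSingularities-0555): the radicial-cover form

Companion to `PAlterationPialtKnownCases.lean` / `PAlterationPialtReductions.lean` /
`PAlterationPialtProjective.lean` (landed `--supports stmt-ResolutionOfSingularities-0555`; does
not close the item). The crux `Pialt` (positive-characteristic slice of the open Abramovich–Oort
conjecture, Temkin 2013 Conj. 1.3.1) asks for a purely inseparable REGULAR ALTERATION of every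
integral variety. Here it is recast, unconditionally, as a statement about FINITE RADICIAL COVERS:

* `exists_radicialCover_hasResolution_of_pialtConclusion` — over a field of characteristic `p`,
  if a NORMAL integral separated `X` of finite type has a proper surjective `g : X₁ → X` with `X₁`
  integral regular, finite and universally injective over a dense open, then `X` has a finite,
  universally injective, surjective cover `h : X'' → X` by an integral scheme `X''` which ADMITS A
  RESOLUTION: `X'' :=` the normalisation of `X` in `X₁` (Stein factorisation `g = g' ≫ h`); `h` is
  finite (E. Noether) and radicial because `X` is normal and `K(X₁)/K(X)` is purely inseparable;
  `g'` is proper birational (Zariski's Main Theorem), so the regular `X₁` resolves `X''`. This is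
  the in-tree `Assembly2` machinery (`isFinite_fromNormalization_of_finiteDimensional`,
  `universallyInjective_fromNormalization`, `hasResolution_normalization_of_isRegular`) with the
  `RadicialBottom` step removed;
* `pialtConclusion_of_exists_radicialCover_hasResolution` — conversely such a cover with a
  resolution `X̃ → X''` composes to a purely inseparable regular alteration `X̃ → X'' → X`;
* `pialt_iff_forall_normal_exists_radicialCover_hasResolution` — **`Pialt` ⇔ every normal
  integral variety over a field of characteristic `p` has a finite radicial cover by an integral
  scheme admitting a resolution of singularities** (with `pialt_iff_forall_normal`).

Reading: a purely inseparable regular alteration of a normal `X` is EXACTLY the choice of one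
finite purely inseparable extension `K'/K(X)` (namely `K(X'')`) whose normalisation `X''` is
resolvable. Temkin's inseparable local uniformization (Temkin 2013, Thm. 1.3.2) provides, for each
valuation `v` of `K(X)`, such a `K'_v` uniformizing `v`; the conjecture asks for one `K'` serving
all valuations at once and for the patching of the local uniformizations on its normalisation.

Sources: M. Temkin, J. Algebra 373 (2013), §1.3 and Rem. 1.3.5(i); A. J. de Jong, Publ. Math.
IHÉS 83 (1996), 2.20; Q. Liu, *Algebraic Geometry and Arithmetic Curves*, Prop. 4.1.27;
Stacks Project, Tags 035Q, 0BXR, 03H0.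
-/

noncomputable section

set_option linter.dupNamespace false -- mandated namespace of this single-conjunct summit

namespace Summit.ResolutionOfSingularities.ResolutionOfSingularities.Theorems

open CategoryTheory AlgebraicGeometry TopologicalSpace
open Literature.AlgebraicGeometry.Resolution Literature.AlgebraicGeometry.Motives
open Literature.AlgebraicGeometry.Motives.RatFn
open Summit.ResolutionOfSingularities.ResolutionOfSingularities.Theses.PAlteration (Pialt)

/-- **From a purely inseparable regular alteration to a resolvable finite radicial cover** (the
Stein-factorisation half of the route's `Assembly2`, without `RadicialBottom`): over a field of
characteristic `p`, let `X` be a NORMAL integral separated scheme of finite type admitting a proper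
surjective `g : X₁ → X` with `X₁` integral regular, finite and universally injective over a dense
open. Then the normalisation `X''` of `X` in `X₁` is integral, finite (E. Noether), universally
injective (normality of `X` and pure inseparability of `K(X₁)/K(X)`) and surjective over `X`, and
`X₁ → X''` is a resolution of `X''` (proper and birational by Zariski's Main Theorem).
[cite: Temkin2013, Rem. 1.3.5(i); Liu2002, Prop. 4.1.27] -/
theorem exists_radicialCover_hasResolution_of_pialtConclusion {p : ℕ} (hp : p.Prime)
    (k : Type) [Field k] [CharP k p] (X : Scheme.{0}) (f : X ⟶ Spec (.of k)) [IsSeparated f]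
    [LocallyOfFiniteType f] [QuasiCompact f] [IsIntegral X]
    (hN : ∀ x : X, IsIntegrallyClosed (X.presheaf.stalk x))
    (h : ∃ (X₁ : Scheme.{0}) (g : X₁ ⟶ X), IsProper g ∧ IsIntegral X₁ ∧ Scheme.IsRegular X₁ ∧
      Function.Surjective g.base ∧ ∃ U : X.Opens, Dense (U : Set X) ∧ IsFinite (g ∣_ U) ∧
        UniversallyInjective (g ∣_ U)) :
    ∃ (X'' : Scheme.{0}) (h : X'' ⟶ X), IsIntegral X'' ∧ IsFinite h ∧ UniversallyInjective h ∧
      Function.Surjective h.base ∧ Scheme.HasResolution X'' := by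
  haveI : Fact p.Prime := ⟨hp⟩
  obtain ⟨X₁, g, hgprop, hint₁, hreg₁, hsurj, U, hUd, hfinU, huiU⟩ := h
  haveI := hgprop
  haveI := hint₁
  haveI : IsDominant g := ⟨hsurj.denseRange⟩
  -- an affine open `V ⊆ U` of `X` containing the generic point
  have hξU : genericPoint X ∈ U :=
    ((genericPoint_spec X).mem_open_set_iff U.isOpen).mpr (by simpa using hUd.nonempty)
  obtain ⟨_, ⟨V, hVaff, rfl⟩, hξV, hVU⟩ :=
    X.isBasis_affineOpens.exists_subset_of_mem_open hξU U.isOpen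
  haveI : IsFinite (g ∣_ V) := morphismRestrict_of_le g (P := @IsFinite) hVU hfinU
  haveI : UniversallyInjective (g ∣_ V) :=
    morphismRestrict_of_le g (P := @UniversallyInjective) hVU huiU
  have hVaff' : IsAffineOpen (g ⁻¹ᵁ V) :=
    isAffineOpen_preimage_of_isAffineHom_morphismRestrict g hVaff
  have hfin : (g.app V).hom.Finite :=
    (IsFinite.SpecMap_iff _).mp
      ((morphismRestrict_iff_specMap_app g hVaff hVaff' (P := @IsFinite)).mp ‹_›)
  haveI : UniversallyInjective (Spec.map (g.app V)) :=
    (morphismRestrict_iff_specMap_app g hVaff hVaff' (P := @UniversallyInjective)).mp ‹_›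
  -- the function field extension `K(X₁)/K(X)` is finite and purely inseparable
  haveI : FiniteDimensional X.functionField (FunctionFieldOver g) :=
    finiteDimensional_functionFieldOver_of_finite g hξV hVaff' hfin
  haveI : IsPurelyInseparable X.functionField (FunctionFieldOver g) :=
    isPurelyInseparable_functionFieldOver_of_universallyInjective g hξV hVaff'
  haveI : CharP X.functionField p := by
    let ι : k →+* X.functionField :=
      (X.presheaf.germ ⊤ (genericPoint X) trivial).hom.comp
        (f.appTop.hom.comp (Scheme.ΓSpecIso (.of k)).inv.hom)
    exact (ι.charP_iff_charP p).mp ‹_›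
  -- the normalization `X'' := g.normalization` of `X` in `X₁`, `g = g' ≫ h`
  haveI hfinh : IsFinite g.fromNormalization :=
    isFinite_fromNormalization_of_finiteDimensional g f
  haveI hui : UniversallyInjective g.fromNormalization :=
    universallyInjective_fromNormalization g hN p
  have hsurjh : Function.Surjective g.fromNormalization.base := by
    intro x
    obtain ⟨x₁, hx₁⟩ := hsurj x
    refine ⟨g.toNormalization.base x₁, ?_⟩
    change (g.toNormalization ≫ g.fromNormalization).base x₁ = x
    rw [g.toNormalization_fromNormalization]
    exact hx₁
  have hne : ((g ⁻¹ᵁ V : X₁.Opens) : Set X₁).Nonempty :=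
    ⟨genericPoint X₁, genericPoint_mem_preimage g hξV⟩
  exact ⟨g.normalization, g.fromNormalization, inferInstance, hfinh, hui, hsurjh,
    hasResolution_normalization_of_isRegular g hreg₁ V hne⟩

/-- **From a resolvable finite radicial cover to a purely inseparable regular alteration**: if
`h : X'' → X` is finite, universally injective and surjective with `X''` integral and `X''` admits
a resolution `π : X̃ → X''`, then `π ≫ h` is a proper surjective morphism from an integral regular
scheme, finite and universally injective over a dense open of `X` (purely inseparable alterations
compose, de Jong 1996, 2.20). [cite: DeJong1996, 2.20] -/
theorem pialtConclusion_of_exists_radicialCover_hasResolution (X : Scheme.{0}) [IsIntegral X]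
    (h : ∃ (X'' : Scheme.{0}) (h : X'' ⟶ X), IsIntegral X'' ∧ IsFinite h ∧ UniversallyInjective h ∧
      Function.Surjective h.base ∧ Scheme.HasResolution X'') :
    ∃ (X' : Scheme.{0}) (g : X' ⟶ X), IsProper g ∧ IsIntegral X' ∧ Scheme.IsRegular X' ∧
      Function.Surjective g.base ∧ ∃ U : X.Opens, Dense (U : Set X) ∧ IsFinite (g ∣_ U) ∧
        UniversallyInjective (g ∣_ U) := by
  obtain ⟨X'', h, hint, hfin, hui, hsurj, hres⟩ := h
  haveI := hint
  haveI := hfin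
  haveI := hui
  haveI : Surjective h := ⟨hsurj⟩
  exact pialtConclusion_of_finite_universallyInjective_surjective h
    (pialtConclusion_of_hasResolution X'' hres)

/-- **`Pialt` in radicial-cover form**: `Pialt` holds if and only if, for every prime `p`, every
field `k` of characteristic `p` and every NORMAL integral separated `k`-scheme `X` of finite type,
there is a finite, universally injective, surjective `h : X'' → X` from an integral scheme `X''`
that admits a resolution of singularities. (⇒: reduce to normal `X` by `pialt_iff_forall_normal`
— trivially, normal varieties are varieties — and Stein-factor the alteration,
`exists_radicialCover_hasResolution_of_pialtConclusion`; ⇐: compose the resolution with the cover,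
`pialtConclusion_of_exists_radicialCover_hasResolution`, and use `pialt_iff_forall_normal`.) So the
conjecture separates into the choice of ONE finite purely inseparable extension `K'/K(X)` and the
resolution of the normalisation of `X` in `K'`. [cite: Temkin2013, §1.3, Rem. 1.3.5(i)] -/
theorem pialt_iff_forall_normal_exists_radicialCover_hasResolution :
    Pialt ↔ ∀ p : ℕ, p.Prime → ∀ (k : Type) [Field k] [CharP k p] (X : Scheme.{0})
      (f : X ⟶ Spec (.of k)), IsSeparated f → LocallyOfFiniteType f → QuasiCompact f →
        IsIntegral X → (∀ x : X, IsIntegrallyClosed (X.presheaf.stalk x)) →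
          ∃ (X'' : Scheme.{0}) (h : X'' ⟶ X), IsIntegral X'' ∧ IsFinite h ∧
            UniversallyInjective h ∧ Function.Surjective h.base ∧ Scheme.HasResolution X'' := by
  rw [pialt_iff_forall_normal]
  refine ⟨fun H p hp k _ _ X f hs hl hq hi hN => ?_, fun H p hp k _ _ X f hs hl hq hi hN => ?_⟩
  · haveI := hs; haveI := hl; haveI := hq; haveI := hi
    exact exists_radicialCover_hasResolution_of_pialtConclusion hp k X f hN
      (H p hp k X f hs hl hq hi hN)
  · haveI := hi
    exact pialtConclusion_of_exists_radicialCover_hasResolution X (H p hp k X f hs hl hq hi hN)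

end Summit.ResolutionOfSingularities.ResolutionOfSingularities.Theorems

end
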